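import Summits.CriticalPhenomena.PercolationContinuityZ3.Theorems.FK.PressureJointConvexity
import Summits.CriticalPhenomena.PercolationContinuityZ3.Theorems.FK.IsingPhaseDiagram
import Summits.CriticalPhenomena.PercolationContinuityZ3.Theorems.FK.NoLatentHeat
import Summits.CriticalPhenomena.PercolationContinuityZ3.Theorems.FK.PressureBetaDerivativeField
import HarnessLib

/-!
# THE DIFFERENTIABILITY SET OF THE ISING PRESSURE AS A FUNCTION OF TWO VARIABLES IS THE UNIQUENESS REGION:
# `(β,h) ↦ ψ(β,h)` is (Fréchet) differentiable at `(β,h)`, `β > 0`, iff `h ≠ 0 ∨ β ≤ β_c(d)` iff `|𝒢(β,h)| = 1` (`d ≥ 2`);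
# a convex function of two variables with both partial derivatives at a point is differentiable there
# (Friedli–Velenik 2017, Thm. 3.25, Prop. 3.29, Thm. 3.34, Thm. 3.43; Rockafellar 1970, Thm. 25.1; Ruelle 1969, §2.6)

Claimed R42 (8)(c) in the cell INBOX at 2026-08-29T04:00:50Z by fkp-10a gen 358 (NEW CLAIM #1 of the gen), addressed to coordinator fk-4 (next seated gen; gen 288 closed l.8706, (ι) in force); lineage row FO-10a-g358 (self-suggested), package g358-surface, label PS-D.
Helper file of the `fk-continuity` build cell (bschramm lane; `--supports stmt-CriticalPhenomena-4575`); builds on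
p205010 (kernel theorem, internal audit signed; external expert review pending). No definitions, no named facts, no
sorries; standard axioms. UNCONDITIONAL (nearest-neighbour Ising model on `ℤ^d`).

The tree knows the two partial derivatives of `ψ` separately: `∂ψ/∂h = βm(β,h)` at `h ≠ 0` and at `h = 0` iff
`m*(β) = 0` (`hasDerivAt_pressure_field`, `differentiableAt_pressure_zero_iff`), `∂ψ/∂β = Σᵢ⟨σ_0σ_{eᵢ}⟩ + h m` at `h ≠ 0`
(`hasDerivAt_pressure_beta_of_pos_field`) and at `h = 0` for `β ≤ β_c` (`hasDerivAt_pressure_beta_of_le_criticalBeta`,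
no latent heat). Separate partial derivatives do not give differentiability in general — but they do for CONVEX
functions, and `ψ` is convex in the canonical couplings `(J,H) = (β, βh)` (`convexOn_pressure_canonical`):

* **`hasFDerivAt_of_convexOn_of_hasDerivAt`** (pure convex analysis on `ℝ × ℝ`) — if `f` is convex on a neighbourhood
  of `p` and `x ↦ f(x, p₂)`, `y ↦ f(p₁, y)` have derivatives `a`, `b` at `p₁`, `p₂`, then `f` has the Fréchet
  derivative `(x,y) ↦ ax + by` at `p` (upper bound from `f(p+u) ≤ ½f(p+2u₁e₁) + ½f(p+2u₂e₂)`, lower bound from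
  `f(p+u) + f(p−u) ≥ 2f(p)`);
* **`hasFDerivAt_pressure_of_hasDerivAt`** — for `β > 0`: if `ψ(·,h)` has derivative `a` at `β` and `ψ(β,·)` has
  derivative `b` at `h`, then `(β,h) ↦ ψ(β,h)` has the Fréchet derivative `(x,y) ↦ ax + by` at `(β,h)` (transport
  through the local diffeomorphism `(β,h) ↦ (β, βh)`);
* **`hasFDerivAt_pressure_of_pos_field`** / `_of_neg_field` (`d ≥ 1`, `β > 0`, `h ≠ 0`; gradient
  `(Σᵢ⟨σ_0σ_{eᵢ}⟩⁺_{β,|h|} + |h| m(β,|h|), sign(h) β m(β,|h|))`), **`hasFDerivAt_pressure_of_le_criticalBeta`**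
  (`d ≥ 2`, `0 < β ≤ β_c`, `h = 0`; gradient `(Σᵢ⟨σ_0σ_{eᵢ}⟩⁺_{β,0}, 0)` — the pressure surface is differentiable ON the
  critical point);
* **`differentiableAt_pressure_uncurry_iff`** — for `d ≥ 2`, `β > 0`, `h ∈ ℝ`:
  `DifferentiableAt ℝ (fun (β,h) => ψ(β,h)) (β,h) ↔ ¬(h = 0 ∧ β_c < β)`: the pressure surface is differentiable
  exactly off the coexistence segment `{h = 0, β > β_c}`;
* **`hasUniqueGibbsMeasure_iff_differentiableAt_pressure_uncurry`** — `|𝒢(β,h)| = 1 ↔` the pressure surface is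
  differentiable at `(β,h)` (the Gibbs phase rule for this model, Friedli–Velenik Thm. 3.34 in two variables);
  `not_differentiableAt_pressure_uncurry_of_criticalBeta_lt` (the kink along the segment).

## References

* S. Friedli, Y. Velenik, *Statistical Mechanics of Lattice Systems*, CUP (2017), Thm. 3.25, Prop. 3.29, Thm. 3.34,
  Thm. 3.43, §3.2.1. [FriedliVelenik2017]
* R. T. Rockafellar, *Convex Analysis*, Princeton (1970), Thm. 25.1 (differentiability of convex functions and the
  existence of partial derivatives). [Rockafellar1970]
* D. Ruelle, *Statistical Mechanics: Rigorous Results*, Benjamin (1969), §2.6. [Ruelle1969]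
-/

noncomputable section

namespace Summit.CriticalPhenomena.PercolationContinuityZ3.Theorems.FK

namespace IsingPressure

open MeasureTheory Filter Topology Finset Set Asymptotics
open Literature.Probability.LatticeModels
open Summit.CriticalPhenomena.PercolationContinuityZ3.Theorems.FK.IsingSusceptibility
open Summit.CriticalPhenomena.PercolationContinuityZ3.Theorems.FK.IsingEnergyDensity

variable {d : ℕ}

/-! ### Convex functions of two variables: partial derivatives give the Fréchet derivative -/

/-- **A convex function of two real variables which has both partial derivatives at a point is (Fréchet) differentiable
there**: if `f` is convex on some neighbourhood `s` of `p`, `x ↦ f (x, p.2)` has derivative `a` at `p.1` and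
`y ↦ f (p.1, y)` has derivative `b` at `p.2`, then `HasFDerivAt f ((x,y) ↦ a x + b y) p`. (Upper estimate: by convexity
`f(p + (x,y)) ≤ ½ f(p + (2x,0)) + ½ f(p + (0,2y))`; lower estimate: `f(p + u) ≥ 2 f(p) − f(p − u)`.)
[cite: Rockafellar1970, Thm. 25.1] -/
theorem hasFDerivAt_of_convexOn_of_hasDerivAt {f : ℝ × ℝ → ℝ} {s : Set (ℝ × ℝ)} {p : ℝ × ℝ} {a b : ℝ}
    (hf : ConvexOn ℝ s f) (hs : s ∈ 𝓝 p) (ha : HasDerivAt (fun x => f (x, p.2)) a p.1)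
    (hb : HasDerivAt (fun y => f (p.1, y)) b p.2) :
    HasFDerivAt f (a • ContinuousLinearMap.fst ℝ ℝ ℝ + b • ContinuousLinearMap.snd ℝ ℝ ℝ) p := by
  rw [hasFDerivAt_iff_isLittleO_nhds_zero, isLittleO_iff]
  intro c hc
  -- the two partial derivatives, in `ε`–`δ` form with `ε = c/2`
  have ha' := (hasDerivAt_iff_isLittleO_nhds_zero.1 ha).def (half_pos hc)
  have hb' := (hasDerivAt_iff_isLittleO_nhds_zero.1 hb).def (half_pos hc)
  obtain ⟨δa, hδa, hA⟩ := Metric.eventually_nhds_iff.1 ha'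
  obtain ⟨δb, hδb, hB⟩ := Metric.eventually_nhds_iff.1 hb'
  obtain ⟨r, hr, hrs⟩ := Metric.mem_nhds_iff.1 hs
  set δ := min (r / 2) (min (δa / 2) (δb / 2)) with hδ
  have hδ0 : 0 < δ := lt_min (by linarith) (lt_min (by linarith) (by linarith))
  have hδr : δ ≤ r / 2 := min_le_left _ _
  have hδa' : δ ≤ δa / 2 := (min_le_right _ _).trans (min_le_left _ _)
  have hδb' : δ ≤ δb / 2 := (min_le_right _ _).trans (min_le_right _ _)
  -- membership in `s` of the points we use
  have hmem : ∀ q : ℝ × ℝ, |q.1| < r → |q.2| < r → p + q ∈ s := by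
    intro q h1 h2
    apply hrs
    rw [Metric.mem_ball, Prod.dist_eq, Real.dist_eq, Real.dist_eq]
    simp only [Prod.fst_add, Prod.snd_add, add_sub_cancel_left]
    exact max_lt h1 h2
  -- THE UPPER ESTIMATE, for every small `u`
  have upper : ∀ u : ℝ × ℝ, ‖u‖ < δ → f (p + u) - f p - (a * u.1 + b * u.2) ≤ c * ‖u‖ := by
    intro u hu
    have hu1 : |u.1| < δ := lt_of_le_of_lt (by rw [Prod.norm_def, Real.norm_eq_abs]; exact le_max_left _ _) hu
    have hu2 : |u.2| < δ := lt_of_le_of_lt (by rw [Prod.norm_def, Real.norm_eq_abs]; exact le_max_right _ _) hu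
    -- the one-dimensional estimates at `2 u.1` and `2 u.2`
    have hA1 : |f (p.1 + 2 * u.1, p.2) - f (p.1, p.2) - 2 * u.1 * a| ≤ c / 2 * |2 * u.1| := by
      have := hA (y := 2 * u.1) (by rw [dist_zero_right, Real.norm_eq_abs, abs_mul, abs_two]; linarith)
      simpa only [Real.norm_eq_abs, smul_eq_mul] using this
    have hB1 : |f (p.1, p.2 + 2 * u.2) - f (p.1, p.2) - 2 * u.2 * b| ≤ c / 2 * |2 * u.2| := by
      have := hB (y := 2 * u.2) (by rw [dist_zero_right, Real.norm_eq_abs, abs_mul, abs_two]; linarith)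
      simpa only [Real.norm_eq_abs, smul_eq_mul] using this
    -- convexity at the midpoint
    have hx : p + ((2 * u.1, 0) : ℝ × ℝ) ∈ s := hmem _ (by simp only [abs_mul, abs_two]; linarith) (by simp; linarith)
    have hy : p + ((0, 2 * u.2) : ℝ × ℝ) ∈ s := hmem _ (by simp; linarith) (by simp only [abs_mul, abs_two]; linarith)
    have hconv := hf.2 hx hy (by norm_num : (0 : ℝ) ≤ 1 / 2) (by norm_num : (0 : ℝ) ≤ 1 / 2) (by norm_num)
    have hmid : (1 / 2 : ℝ) • (p + ((2 * u.1, 0) : ℝ × ℝ)) + (1 / 2 : ℝ) • (p + ((0, 2 * u.2) : ℝ × ℝ)) = p + u := by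
      ext <;> simp <;> ring
    have e3 : p + ((2 * u.1, 0) : ℝ × ℝ) = (p.1 + 2 * u.1, p.2) := by ext <;> simp
    have e4 : p + ((0, 2 * u.2) : ℝ × ℝ) = (p.1, p.2 + 2 * u.2) := by ext <;> simp
    rw [hmid, e3, e4] at hconv
    simp only [smul_eq_mul] at hconv
    have hp : f p = f (p.1, p.2) := rfl
    rw [abs_le] at hA1 hB1
    rw [abs_mul, abs_two] at hA1 hB1
    have hn : |u.1| ≤ ‖u‖ ∧ |u.2| ≤ ‖u‖ := by
      rw [Prod.norm_def, Real.norm_eq_abs, Real.norm_eq_abs]; exact ⟨le_max_left _ _, le_max_right _ _⟩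
    have hn1 := mul_le_mul_of_nonneg_left hn.1 hc.le
    have hn2 := mul_le_mul_of_nonneg_left hn.2 hc.le
    rw [hp]
    linarith [hA1.2, hB1.2]
  -- conclusion from `upper u` and `upper (-u)` with `f (p + u) + f (p - u) ≥ 2 f p`
  rw [Metric.eventually_nhds_iff]
  refine ⟨δ, hδ0, fun u hu => ?_⟩
  rw [dist_zero_right] at hu
  have h1 := upper u hu
  have h2 := upper (-u) (by rwa [norm_neg])
  have hu' : |u.1| < δ ∧ |u.2| < δ := by
    have := hu; rw [Prod.norm_def, Real.norm_eq_abs, Real.norm_eq_abs] at this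
    exact max_lt_iff.1 this
  have hpu : p + u ∈ s := hmem u (by linarith [hu'.1]) (by linarith [hu'.2])
  have hmu : p + -u ∈ s :=
    hmem (-u) (by rw [Prod.fst_neg, abs_neg]; linarith [hu'.1]) (by rw [Prod.snd_neg, abs_neg]; linarith [hu'.2])
  have hconv := hf.2 hpu hmu (by norm_num : (0 : ℝ) ≤ 1 / 2) (by norm_num : (0 : ℝ) ≤ 1 / 2) (by norm_num)
  have hmid : (1 / 2 : ℝ) • (p + u) + (1 / 2 : ℝ) • (p + -u) = p := by ext <;> simp <;> ring
  rw [hmid] at hconv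
  simp only [smul_eq_mul] at hconv
  simp only [Prod.fst_neg, Prod.snd_neg, norm_neg] at h2
  rw [Real.norm_eq_abs, abs_le]
  simp only [add_apply, smul_apply, ContinuousLinearMap.coe_fst', smul_eq_mul, ContinuousLinearMap.coe_snd']
  constructor <;> linarith

/-! ### The pressure surface: Fréchet differentiability from the two partial derivatives -/

/-- **For `β > 0`: if `ψ(·,h)` has derivative `a` at `β` and `ψ(β,·)` has derivative `b` at `h`, then
`(β,h) ↦ ψ(β,h)` has the Fréchet derivative `(x,y) ↦ a x + b y` at `(β,h)`** — the pressure is convex in the canonical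
couplings `(J,H) = (β, βh)` (`convexOn_pressure_canonical`), the partial derivatives of `ψ` are directional
derivatives of that convex function along two independent directions, and `(β,h) ↦ (β, βh)` is a local
diffeomorphism on `{β > 0}`. [cite: Rockafellar1970, Thm. 25.1; FriedliVelenik2017, Thm. 3.6 and §3.2.1] -/
theorem hasFDerivAt_pressure_of_hasDerivAt {β h a b : ℝ} (hβ : 0 < β)
    (ha : HasDerivAt (fun x => pressure d x h) a β) (hb : HasDerivAt (fun y => pressure d β y) b h) :
    HasFDerivAt (fun p : ℝ × ℝ => pressure d p.1 p.2)
      (a • ContinuousLinearMap.fst ℝ ℝ ℝ + b • ContinuousLinearMap.snd ℝ ℝ ℝ) (β, h) := by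
  -- the convex function `Ψ(J,H) = ψ(J, H/J)` precomposed with the affine chart `A(s,t) = (β + s, βh + hs + t)`
  set G : ℝ × ℝ → ℝ := fun q => pressure d (β + q.1) ((β * h + h * q.1 + q.2) / (β + q.1)) with hG
  set S : Set (ℝ × ℝ) := {q | -β < q.1} with hS
  have hSopen : IsOpen S := isOpen_lt continuous_const continuous_fst
  have hS0 : S ∈ 𝓝 (0 : ℝ × ℝ) := hSopen.mem_nhds (by simp [hS, hβ])
  -- `G` is convex on `S`
  have hGconv : ConvexOn ℝ S G := by
    refine ⟨convex_halfSpace_gt (LinearMap.fst ℝ ℝ ℝ).isLinear (-β), fun x hx y hy a' b' ha' hb' hab => ?_⟩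
    have hx1 : 0 < β + x.1 := by have := hx; rw [hS, mem_setOf_eq] at this; linarith
    have hy1 : 0 < β + y.1 := by have := hy; rw [hS, mem_setOf_eq] at this; linarith
    have key := (convexOn_pressure_canonical (d := d)).2 (x := (β + x.1, β * h + h * x.1 + x.2))
      (y := (β + y.1, β * h + h * y.1 + y.2)) (mk_mem_prod hx1 (mem_univ _)) (mk_mem_prod hy1 (mem_univ _)) ha' hb' hab
    have e1 : a' * (β + x.1) + b' * (β + y.1) = β + (a' * x.1 + b' * y.1) := by
      linear_combination β * hab
    have e2 : a' * (β * h + h * x.1 + x.2) + b' * (β * h + h * y.1 + y.2) =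
        β * h + h * (a' * x.1 + b' * y.1) + (a' * x.2 + b' * y.2) := by
      linear_combination (β * h) * hab
    simp only [hG, smul_eq_mul, Prod.smul_mk, Prod.mk_add_mk, Prod.fst_add, Prod.snd_add, Prod.smul_fst,
      Prod.smul_snd, e1, e2] at key ⊢
    exact key
  -- partial derivative of `G` in `s` at `0`: `G(s,0) = ψ(β+s, h)` near `s = 0`
  have hGa : HasDerivAt (fun s => G (s, (0 : ℝ × ℝ).2)) a (0 : ℝ × ℝ).1 := by
    have h1 : HasDerivAt (fun s => pressure d (β + s) h) a 0 :=
      HasDerivAt.comp_const_add β 0 (by simpa using ha)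
    refine h1.congr_of_eventuallyEq ?_
    have hev : ∀ᶠ s : ℝ in 𝓝 0, -β < s := (isOpen_lt continuous_const continuous_id).mem_nhds (by simpa using hβ)
    filter_upwards [hev] with s hs
    have hne : β + s ≠ 0 := by linarith
    simp only [hG, Prod.snd_zero, add_zero]
    congr 1
    field_simp
  -- partial derivative of `G` in `t` at `0`: `G(0,t) = ψ(β, h + t/β)`
  have hGb : HasDerivAt (fun t => G ((0 : ℝ × ℝ).1, t)) (b / β) (0 : ℝ × ℝ).2 := by
    have hlin : HasDerivAt (fun t : ℝ => h + t / β) (1 / β) 0 := by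
      simpa using ((hasDerivAt_id (0 : ℝ)).div_const β).const_add h
    have hb' : HasDerivAt (fun y => pressure d β y) b (h + 0 / β) := by simpa using hb
    have hcomp := hb'.comp 0 hlin
    have e : b * (1 / β) = b / β := by ring
    rw [e] at hcomp
    refine hcomp.congr_of_eventuallyEq (Eventually.of_forall fun t => ?_)
    simp only [hG, Prod.fst_zero, add_zero, Function.comp_apply]
    congr 1
    field_simp
    ring
  have hGderiv := hasFDerivAt_of_convexOn_of_hasDerivAt hGconv hS0 hGa hGb
  -- the chart `Φ(x,y) = (x − β, x (y − h))` with `G ∘ Φ = ψ` near `(β,h)` and `DΦ(β,h) = (dx, β dy)`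
  set Φ : ℝ × ℝ → ℝ × ℝ := fun q => (q.1 - β, q.1 * (q.2 - h)) with hΦ
  have hΦderiv : HasFDerivAt Φ
      ((ContinuousLinearMap.fst ℝ ℝ ℝ).prod ((β, h).1 • ContinuousLinearMap.snd ℝ ℝ ℝ +
        ((β, h).2 - h) • ContinuousLinearMap.fst ℝ ℝ ℝ)) (β, h) :=
    (hasFDerivAt_fst.sub_const β).prodMk (hasFDerivAt_fst.mul (hasFDerivAt_snd.sub_const h))
  have hΦ0 : Φ (β, h) = 0 := by simp [hΦ]
  have hG' : HasFDerivAt G (a • ContinuousLinearMap.fst ℝ ℝ ℝ + (b / β) • ContinuousLinearMap.snd ℝ ℝ ℝ) (Φ (β, h)) := by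
    rw [hΦ0]; exact hGderiv
  have hcomp := hG'.comp (β, h) hΦderiv
  -- identify the composite derivative and the composite function
  have hL : (a • ContinuousLinearMap.fst ℝ ℝ ℝ + (b / β) • ContinuousLinearMap.snd ℝ ℝ ℝ).comp
      ((ContinuousLinearMap.fst ℝ ℝ ℝ).prod ((β, h).1 • ContinuousLinearMap.snd ℝ ℝ ℝ +
        ((β, h).2 - h) • ContinuousLinearMap.fst ℝ ℝ ℝ)) =
      a • ContinuousLinearMap.fst ℝ ℝ ℝ + b • ContinuousLinearMap.snd ℝ ℝ ℝ := by
    refine ContinuousLinearMap.ext fun v => ?_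
    rcases v with ⟨x, y⟩
    simp only [sub_self, zero_smul, add_zero, ContinuousLinearMap.add_comp, ContinuousLinearMap.smul_comp,
      ContinuousLinearMap.fst_comp_prod, ContinuousLinearMap.snd_comp_prod, add_apply, smul_apply,
      ContinuousLinearMap.coe_fst', smul_eq_mul, ContinuousLinearMap.coe_snd', add_right_inj]
    field_simp
  rw [hL] at hcomp
  refine hcomp.congr_of_eventuallyEq ?_
  have hev : ∀ᶠ q : ℝ × ℝ in 𝓝 (β, h), 0 < q.1 :=
    (isOpen_lt continuous_const continuous_fst).mem_nhds (by simpa using hβ)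
  filter_upwards [hev] with q hq
  have e1 : β + (q.1 - β) = q.1 := by ring
  have e2 : β * h + h * (q.1 - β) + q.1 * (q.2 - h) = q.1 * q.2 := by ring
  simp only [Function.comp_apply, hG, hΦ, e1, e2, mul_div_cancel_left₀ _ hq.ne']

/-- **`h > 0`: the pressure surface is differentiable at `(β,h)`** (`d ≥ 1`, `β > 0`), with gradient
`(Σᵢ ⟨σ_0σ_{eᵢ}⟩⁺_{β,h} + h m(β,h), β m(β,h))`. [cite: FriedliVelenik2017, Thm. 3.43, Thm. 3.25 (1) and Thm. 3.6] -/
theorem hasFDerivAt_pressure_of_pos_field (hd : 1 ≤ d) {β h : ℝ} (hβ : 0 < β) (hh : 0 < h) :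
    HasFDerivAt (fun p : ℝ × ℝ => pressure d p.1 p.2)
      ((∑ i, plusCorr d β h {0, Pi.single i 1} + h * magnetizationInField d β h) • ContinuousLinearMap.fst ℝ ℝ ℝ +
        (β * magnetizationInField d β h) • ContinuousLinearMap.snd ℝ ℝ ℝ) (β, h) :=
  hasFDerivAt_pressure_of_hasDerivAt hβ (hasDerivAt_pressure_beta_of_pos_field hd hβ hh)
    (hasDerivAt_pressure_field hd hβ.le hh)

/-- **`h < 0`: the pressure surface is differentiable at `(β,h)`** (`d ≥ 1`, `β > 0`), with gradient
`(Σᵢ ⟨σ_0σ_{eᵢ}⟩⁺_{β,−h} + (−h) m(β,−h), −β m(β,−h))` (spin-flip symmetry `ψ(β,−h) = ψ(β,h)`).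
[cite: FriedliVelenik2017, §3.7.1, Thm. 3.43 and Thm. 3.6] -/
theorem hasFDerivAt_pressure_of_neg_field (hd : 1 ≤ d) {β h : ℝ} (hβ : 0 < β) (hh : h < 0) :
    HasFDerivAt (fun p : ℝ × ℝ => pressure d p.1 p.2)
      ((∑ i, plusCorr d β (-h) {0, Pi.single i 1} + (-h) * magnetizationInField d β (-h)) •
          ContinuousLinearMap.fst ℝ ℝ ℝ +
        (-(β * magnetizationInField d β (-h))) • ContinuousLinearMap.snd ℝ ℝ ℝ) (β, h) :=
  hasFDerivAt_pressure_of_hasDerivAt hβ (hasDerivAt_pressure_beta_of_neg_field hd hβ hh)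
    (hasDerivAt_pressure_field_of_neg hd hβ.le hh)

/-- **`h = 0`, `0 < β ≤ β_c(d)` (`d ≥ 2`): the pressure surface is differentiable at `(β,0)`, INCLUDING AT THE CRITICAL
POINT `(β_c, 0)`**, with gradient `(Σᵢ ⟨σ_0σ_{eᵢ}⟩⁺_{β,0}, 0)` (`∂ψ/∂h(β,0) = β m*(β) = 0` by the continuity of the
magnetisation, `∂ψ/∂β` exists by the absence of latent heat). [cite: FriedliVelenik2017, Prop. 3.29, Thm. 3.34; AizenmanDuminilCopinSidoraviciusCMP2015, Thm. 1.2; Lebowitz1977, §3, Thm. 2] -/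
theorem hasFDerivAt_pressure_of_le_criticalBeta (hd : 2 ≤ d) {β : ℝ} (hβ : 0 < β) (hβc : β ≤ criticalBeta d) :
    HasFDerivAt (fun p : ℝ × ℝ => pressure d p.1 p.2)
      ((∑ i, plusCorr d β 0 {0, Pi.single i 1}) • ContinuousLinearMap.fst ℝ ℝ ℝ +
        (0 : ℝ) • ContinuousLinearMap.snd ℝ ℝ ℝ) (β, 0) := by
  have hm : spontaneousMagnetization d β = 0 := spontaneousMagnetization_eq_zero_of_le_criticalBeta_two_le hd hβ.le hβc
  have hR := hasDerivWithinAt_pressure_field_zero (d := d) (by omega) hβ.le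
  have hL := hasDerivWithinAt_pressure_field_zero_left (d := d) (by omega) hβ.le
  rw [hm, mul_zero] at hR hL
  rw [neg_zero] at hL
  have hb : HasDerivAt (fun y => pressure d β y) 0 0 := by
    have := hL.union hR
    rwa [Iic_union_Ici, hasDerivWithinAt_univ] at this
  exact hasFDerivAt_pressure_of_hasDerivAt hβ (hasDerivAt_pressure_beta_of_le_criticalBeta hd hβ hβc) hb

/-! ### The differentiability set is the uniqueness region -/

/-- **THE PRESSURE SURFACE IS NOT DIFFERENTIABLE ON THE COEXISTENCE SEGMENT**: for `d ≥ 2` and `β > β_c(d)`,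
`(β,h) ↦ ψ(β,h)` is not differentiable at `(β,0)` (its restriction to the line `β = const` has the kink `±β m*(β)`,
`m*(β) > 0`). [cite: FriedliVelenik2017, Thm. 3.34 and Thm. 3.25 (3)] -/
theorem not_differentiableAt_pressure_uncurry_of_criticalBeta_lt (hd : 2 ≤ d) {β : ℝ} (hβc : criticalBeta d < β) :
    ¬ DifferentiableAt ℝ (fun p : ℝ × ℝ => pressure d p.1 p.2) (β, 0) := by
  intro hD
  have h1 : DifferentiableAt ℝ (fun t : ℝ => pressure d β t) 0 := by
    have hline : DifferentiableAt ℝ (fun t : ℝ => ((β, t) : ℝ × ℝ)) 0 :=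
      (differentiableAt_const β).prodMk differentiableAt_id
    exact hD.comp 0 hline
  exact not_differentiableAt_pressure_zero_of_criticalBeta_lt hd hβc h1

/-- **THE DIFFERENTIABILITY SET OF THE PRESSURE SURFACE** (`d ≥ 2`, `β > 0`, `h ∈ ℝ`):
`(β,h) ↦ ψ(β,h)` is differentiable at `(β,h)` **iff** `¬(h = 0 ∧ β_c(d) < β)` — everywhere except on the coexistence
segment `{h = 0, β > β_c}`, and in particular AT the critical point. [cite: FriedliVelenik2017, Thm. 3.25, Thm. 3.34, Thm. 3.43; Rockafellar1970, Thm. 25.1] -/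
theorem differentiableAt_pressure_uncurry_iff (hd : 2 ≤ d) {β : ℝ} (hβ : 0 < β) (h : ℝ) :
    DifferentiableAt ℝ (fun p : ℝ × ℝ => pressure d p.1 p.2) (β, h) ↔ ¬ (h = 0 ∧ criticalBeta d < β) := by
  constructor
  · rintro hD ⟨rfl, hβc⟩
    exact not_differentiableAt_pressure_uncurry_of_criticalBeta_lt hd hβc hD
  · intro hne
    rcases lt_trichotomy h 0 with hneg | rfl | hpos
    · exact (hasFDerivAt_pressure_of_neg_field (by omega) hβ hneg).differentiableAt
    · have hβc : β ≤ criticalBeta d := by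
        by_contra hlt
        exact hne ⟨rfl, not_le.1 hlt⟩
      exact (hasFDerivAt_pressure_of_le_criticalBeta hd hβ hβc).differentiableAt
    · exact (hasFDerivAt_pressure_of_pos_field (by omega) hβ hpos).differentiableAt

/-- **THE GIBBS PHASE RULE FOR THE NEAREST-NEIGHBOUR ISING MODEL, IN TWO VARIABLES** (`d ≥ 2`, `β > 0`, `h ∈ ℝ`):
`|𝒢(β,h)| = 1 ↔ (β,h) ↦ ψ(β,h)` is (Fréchet) differentiable at `(β,h)` — uniqueness of the infinite-volume Gibbs
measure is exactly differentiability of the pressure surface (Friedli–Velenik Thm. 3.34 `⟺` in both variables at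
once, via the phase diagram `hasUniqueGibbsMeasure_iff`). [cite: FriedliVelenik2017, Thm. 3.34 and Thm. 3.25; Ruelle1969, §2.6] -/
theorem hasUniqueGibbsMeasure_iff_differentiableAt_pressure_uncurry (hd : 2 ≤ d) {β : ℝ} (hβ : 0 < β) (h : ℝ) :
    HasUniqueGibbsMeasure (isingSpecification (zdGraph d) β h) ↔
      DifferentiableAt ℝ (fun p : ℝ × ℝ => pressure d p.1 p.2) (β, h) := by
  rw [hasUniqueGibbsMeasure_iff hd hβ h, differentiableAt_pressure_uncurry_iff hd hβ h]
  constructor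
  · rintro (hh | hle) ⟨h0, hlt⟩
    · exact hh h0
    · exact absurd hlt (not_lt.2 hle)
  · intro hne
    by_cases hh : h = 0
    · right; by_contra hlt; exact hne ⟨hh, not_le.1 hlt⟩
    · exact Or.inl hh

/-- **Phase coexistence = a kink of the pressure surface** (`d ≥ 2`, `β > 0`, `h ∈ ℝ`):
`¬ |𝒢(β,h)| = 1 ↔ ¬ DifferentiableAt ψ̃ (β,h) ↔ (h = 0 ∧ β_c < β)`. [cite: FriedliVelenik2017, Thm. 3.34 and Thm. 3.25] -/
theorem not_differentiableAt_pressure_uncurry_iff (hd : 2 ≤ d) {β : ℝ} (hβ : 0 < β) (h : ℝ) :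
    ¬ DifferentiableAt ℝ (fun p : ℝ × ℝ => pressure d p.1 p.2) (β, h) ↔ (h = 0 ∧ criticalBeta d < β) := by
  rw [differentiableAt_pressure_uncurry_iff hd hβ h, not_not]

/-- **The pressure surface is differentiable on the whole open set `{β > 0, h ≠ 0} ∪ {0 < β ≤ β_c}`… in particular on
the two open half-planes `{β > 0, h > 0}` and `{β > 0, h < 0}`** (`d ≥ 1`). [cite: FriedliVelenik2017, Thm. 3.43 and Thm. 3.25 (1)] -/
theorem differentiableOn_pressure_uncurry_of_field_ne_zero (hd : 1 ≤ d) :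
    DifferentiableOn ℝ (fun p : ℝ × ℝ => pressure d p.1 p.2) {p | 0 < p.1 ∧ p.2 ≠ 0} := by
  intro p hp
  rcases hp.2.lt_or_gt with hneg | hpos
  · exact (hasFDerivAt_pressure_of_neg_field hd hp.1 hneg).differentiableAt.differentiableWithinAt
  · exact (hasFDerivAt_pressure_of_pos_field hd hp.1 hpos).differentiableAt.differentiableWithinAt

end IsingPressure

end Summit.CriticalPhenomena.PercolationContinuityZ3.Theorems.FK

end
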